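import Summits.Ventures.CertifiedManyBodySolver.Upper.IntervalReaderBoxEnergy
import Summits.Ventures.CertifiedManyBodySolver.Upper.DWaveSourceOpenBoxParticleHole
import Summits.Ventures.CertifiedManyBodySolver.Upper.PartialParticleHoleInvolution

/-!
# Ventures/CertifiedManyBodySolver — Upper/IntervalReaderSourcedBoxEnergy.lean: the transformed-frame SOURCED box (W5 / FORMAT-mpsgf1)
(part 11 of the Theorem-H1′ package; parts 1–10: `IntervalReaderSchur` … `IntervalReaderBoxEnergy`)

HONEST FRAMING: first certified bounds; not a superconductivity verdict; a sourced-Hamiltonian upper is a certified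
variational ENERGY CEILING for `H − μN − h(Δ_d + Δ_d†)` on one finite box, never a sign of order, never a phase word.
This file is pure algebra about what a reader of such a certificate computes; no number is certified, no row moves.

The W5 certificates (`Certificates/HubbardSquare_n7o8_sourced_*`, FORMAT-mpsgf1) ship an integer MPS `ψ̃` in Lieb's
partially particle–hole transformed frame; the tree's consumer `Upper/SourcedBoxNodeOfTransformedWitness.lean`
(`sourcedBoxNode_of_transformedWitness`, IRD desk seat 5) takes as hypothesis the TRANSFORMED sentence
`Re ⟨ψ̃, (Wᴴ A_C W) ψ̃⟩ ≤ e·ab·⟨ψ̃, ψ̃⟩`, `W = partialParticleHole D↓`, `A_C = dWaveSourceOpenBox a b U μ h`, and the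
tree knows (`partialParticleHole_conj_dWaveSourceOpenBox`, Lieb 1989) that the conjugated operator CONSERVES particle
number: `W A_C Wᴴ = dΓ(𝓗) − μ·ab·1 + U (N_↑ − Σ_x n_{x↑}n_{x↓})` with `𝓗` the BdG–Nambu one-body matrix.  Hence
(this file):

* §U the ONE-BODY dictionary: `toSpin (c†_i c_j) = productOp (orbWordFamily x y σ τ)` for ALL orbital pairs
  (same site: the on-site word `c†_σ c_τ`, no string; distinct sites: part 9's `hopFamily`), and
  `toSpin (dΓ M) = Σ_{i,j} M i j • productOp (…)` for every one-body matrix `M` (`toSpin_dGamma_eq_sum_productOp`);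
* §V `inner_toSpin_dGamma_compEquiv_mpsOpenVar`: `⟨Ψ, toSpin (dΓ M) Ψ⟩ = Σ_{i,j} M i j · S(word_{ij} ∘ e)` for the
  pulled-back witness `Ψ k = mpsOpenVar N A l r (k ∘ e)`, plus the number / double-occupancy / identity sweeps;
* §W `inner_transformedSourcedBox_mpsOpenVar`: for `ψ̃ := toSpinVec⁻¹ Ψ` (the Fock-side vector the consumer speaks
  about), `star ψ̃ ⬝ᵥ ((Wᴴ A_C W) *ᵥ ψ̃)` = `Σ_{i,j} 𝓗 i j · S(word_{ij} ∘ e) − μ·ab · S(1) + U (Σ_x S(n_↑ at x ∘ e) − Σ_x S(n_↑n_↓ at x ∘ e))`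
  and `star ψ̃ ⬝ᵥ ψ̃ = S(1)` — every `S(·) = sweepPairing (a·b) A · l l r r` ONE one-state sweep of part 2's `transferOp`.

So for the W5 class too, both sides of the reader's sentence are explicit finite contractions of the integer witness
data (the sgf reader's `l3core` substrate encloses exactly such sweeps, Theorem H1′).  Not covered: the producers'
diagonal `±1` gauge on the down modes (the tree's `gaugedShiba*` lemmas say it changes no Rayleigh quotient).
-/

noncomputable section

open Matrix Finset
open scoped BigOperators ComplexOrder

namespace Summit.Ventures.CertifiedManyBodySolver.Upper.IntervalReader

open Literature.MathematicalPhysics.QuantumLattice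
open Literature.MathematicalPhysics.QuantumLattice.JordanWigner
open Literature.MathematicalPhysics.QuantumLattice.HubbardWave0

/-! ## §U  One-body words as product operators -/

section Dictionary

variable {Λ : Type*} [LinearOrder Λ] [Fintype Λ]

/-- Same-site word: `toSpin (c†_{xσ} c_{xτ}) = (c†_σ c_τ)_x` (the two strings cancel, `F² = 1`). -/
theorem toSpin_creation_mul_annihilation_same (x : Λ) (σ τ : Fin 2) :
    toSpin (creation (orb x σ) * annihilation (orb x τ)) = onSite x (siteCreation σ * siteAnnihilation τ) := by
  rw [map_mul, toSpin_creation, toSpin_annihilation, Matrix.mul_assoc, ← Matrix.mul_assoc (jwString x),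
    jwString_mul_jwString, Matrix.one_mul, onSite_mul]

/-- The product family of the one-body word `c†_{xσ} c_{yτ}` for ANY pair of orbitals: on-site word if `x = y`,
part 9's `hopFamily` (ladder matrices + parity string) otherwise. -/
def orbWordFamily (x y : Λ) (σ τ : Fin 2) : Λ → Matrix (Fin 4) (Fin 4) ℂ :=
  if x = y then Function.update (fun _ => (1 : Matrix (Fin 4) (Fin 4) ℂ)) x (siteCreation σ * siteAnnihilation τ)
  else hopFamily x y σ τ

/-- **Every one-body word is ONE product operator**: `toSpin (c†_{xσ} c_{yτ}) = productOp (orbWordFamily x y σ τ)`. -/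
theorem toSpin_creation_mul_annihilation_eq_productOp' (x y : Λ) (σ τ : Fin 2) :
    toSpin (creation (orb x σ) * annihilation (orb y τ)) = productOp (orbWordFamily x y σ τ) := by
  unfold orbWordFamily
  split_ifs with h
  · subst h
    rw [toSpin_creation_mul_annihilation_same, onSite_eq_productOp]
  · exact toSpin_creation_mul_annihilation_eq_productOp h σ τ

/-- **Second quantisation of a one-body matrix is a sum of product operators**:
`toSpin (dΓ M) = Σ_{i,j} M i j • productOp (orbWordFamily xᵢ xⱼ σᵢ σⱼ)` (`i = (xᵢ, σᵢ)`). -/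
theorem toSpin_dGamma_eq_sum_productOp (M : Matrix (Orb Λ) (Orb Λ) ℂ) :
    toSpin (dGamma M) = ∑ i : Orb Λ, ∑ j : Orb Λ,
      M i j • productOp (orbWordFamily (ofLex i).1 (ofLex j).1 (ofLex i).2 (ofLex j).2) := by
  rw [dGamma_eq, map_sum]
  refine Finset.sum_congr rfl fun i _ => ?_
  rw [map_sum]
  refine Finset.sum_congr rfl fun j _ => ?_
  rw [map_smul, ← toSpin_creation_mul_annihilation_eq_productOp']
  rfl

/-- Number operator: `toSpin (n_{xσ}) = productOp (n_σ at x)`. -/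
theorem toSpin_numberOp_eq_productOp (x : Λ) (σ : Fin 2) :
    toSpin (numberOp x σ) = productOp (Function.update (fun _ => (1 : Matrix (Fin 4) (Fin 4) ℂ)) x (siteNumber σ)) := by
  rw [toSpin_numberOp, onSite_eq_productOp]

/-- Double occupancy: `toSpin (n_{x↑} n_{x↓}) = productOp (n_↑n_↓ at x)`. -/
theorem toSpin_numberOp_mul_numberOp_eq_productOp (x : Λ) :
    toSpin (numberOp x 0 * numberOp x 1) =
      productOp (Function.update (fun _ => (1 : Matrix (Fin 4) (Fin 4) ℂ)) x siteDouble) := by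
  rw [toSpin_numberOp_mul_numberOp, onSite_eq_productOp]

end Dictionary

/-! ## §V  The sweeps of one-body, number and identity words along an enumeration -/

section Sweeps

variable {Λ : Type*} [LinearOrder Λ] [Fintype Λ] {D N : ℕ}

/-- `⟨Ψ, toSpin (dΓ M) Ψ⟩ = Σ_{i,j} M i j · S(word_{ij} ∘ e)` for the pulled-back witness `Ψ k = mpsOpenVar N A l r (k ∘ e)`. -/
theorem inner_toSpin_dGamma_compEquiv_mpsOpenVar (M : Matrix (Orb Λ) (Orb Λ) ℂ) (e : Fin N ≃ Λ)
    (A : Fin N → MPSTensor 4 D) (l r : Fin D → ℂ) :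
    star (fun k : TensorIndex Λ 4 => mpsOpenVar N A l r (fun i => k (e i))) ⬝ᵥ
        (toSpin (dGamma M) *ᵥ fun k : TensorIndex Λ 4 => mpsOpenVar N A l r (fun i => k (e i))) =
      ∑ i : Orb Λ, ∑ j : Orb Λ, M i j *
        sweepPairing N A (fun k => orbWordFamily (ofLex i).1 (ofLex j).1 (ofLex i).2 (ofLex j).2 (e k)) l l r r := by
  rw [toSpin_dGamma_eq_sum_productOp, Matrix.sum_mulVec, dotProduct_sum]
  refine Finset.sum_congr rfl fun i _ => ?_
  rw [Matrix.sum_mulVec, dotProduct_sum]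
  refine Finset.sum_congr rfl fun j _ => ?_
  rw [smul_mulVec, dotProduct_smul, smul_eq_mul, inner_productOp_compEquiv, inner_productOp_mpsOpenVar]

/-- `⟨Ψ, toSpin (n_{xσ}) Ψ⟩ = S(n_σ at x ∘ e)`. -/
theorem inner_toSpin_numberOp_compEquiv_mpsOpenVar (x : Λ) (σ : Fin 2) (e : Fin N ≃ Λ)
    (A : Fin N → MPSTensor 4 D) (l r : Fin D → ℂ) :
    star (fun k : TensorIndex Λ 4 => mpsOpenVar N A l r (fun i => k (e i))) ⬝ᵥ
        (toSpin (numberOp x σ) *ᵥ fun k : TensorIndex Λ 4 => mpsOpenVar N A l r (fun i => k (e i))) =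
      sweepPairing N A
        (fun k => Function.update (fun _ => (1 : Matrix (Fin 4) (Fin 4) ℂ)) x (siteNumber σ) (e k)) l l r r := by
  rw [toSpin_numberOp_eq_productOp, inner_productOp_compEquiv, inner_productOp_mpsOpenVar]

/-- `⟨Ψ, toSpin (n_{x↑}n_{x↓}) Ψ⟩ = S(n_↑n_↓ at x ∘ e)`. -/
theorem inner_toSpin_numberOp_mul_numberOp_compEquiv_mpsOpenVar (x : Λ) (e : Fin N ≃ Λ)
    (A : Fin N → MPSTensor 4 D) (l r : Fin D → ℂ) :
    star (fun k : TensorIndex Λ 4 => mpsOpenVar N A l r (fun i => k (e i))) ⬝ᵥ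
        (toSpin (numberOp x 0 * numberOp x 1) *ᵥ fun k : TensorIndex Λ 4 => mpsOpenVar N A l r (fun i => k (e i))) =
      sweepPairing N A
        (fun k => Function.update (fun _ => (1 : Matrix (Fin 4) (Fin 4) ℂ)) x siteDouble (e k)) l l r r := by
  rw [toSpin_numberOp_mul_numberOp_eq_productOp, inner_productOp_compEquiv, inner_productOp_mpsOpenVar]

/-- `⟨Ψ, Ψ⟩ = S(1)` (part 6's norm sweep, through the relabelling). -/
theorem star_compEquiv_dotProduct_mpsOpenVar (e : Fin N ≃ Λ) (A : Fin N → MPSTensor 4 D) (l r : Fin D → ℂ) :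
    star (fun k : TensorIndex Λ 4 => mpsOpenVar N A l r (fun i => k (e i))) ⬝ᵥ
        (fun k : TensorIndex Λ 4 => mpsOpenVar N A l r (fun i => k (e i))) =
      sweepPairing N A (fun _ => (1 : Matrix (Fin 4) (Fin 4) ℂ)) l l r r := by
  rw [star_compEquiv_dotProduct, star_dotProduct_mpsOpenVar_eq_envSweep]
  rfl

end Sweeps

/-! ## §W  The W5 sourced box in the transformed frame -/

section SourcedBox

variable {D : ℕ}

/-- **The transformed sourced-box sentence, as sweeps.**  Let `A_C = dWaveSourceOpenBox a b U μ h`,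
`W = partialParticleHole D↓`, `Ψ k = mpsOpenVar (a·b) A l r (k ∘ e)` the FORMAT-mpsgf1 witness read along an
enumeration `e` in the Jordan–Wigner product basis, and `ψ̃ = toSpinVec⁻¹ Ψ` the Fock-side vector the consumer
`sourcedBoxNode_of_transformedWitness` speaks about.  Then
`star ψ̃ ⬝ᵥ ((Wᴴ A_C W) ψ̃) = Σ_{i,j} 𝓗 i j · S(word_{ij} ∘ e) − μ·ab · S(1) + U · (Σ_x S(n_↑ at x ∘ e) − Σ_x S(n_↑n_↓ at x ∘ e))`
with `𝓗 = bdgNambuMatrix (−[p∼q]) (−h·w_C) μ` (Lieb's transform, `partialParticleHole_conj_dWaveSourceOpenBox`) and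
`S O = sweepPairing (a·b) A O l l r r`. -/
theorem inner_transformedSourcedBox_mpsOpenVar (a b : ℕ) (U μ h : ℝ) (e : Fin (a * b) ≃ (Fin a ×ₗ Fin b))
    (A : Fin (a * b) → MPSTensor 4 D) (l r : Fin D → ℂ) :
    let Ψ : TensorIndex (Fin a ×ₗ Fin b) 4 → ℂ := fun k => mpsOpenVar (a * b) A l r (fun i => k (e i))
    star (toSpinVec.symm Ψ) ⬝ᵥ
        (((partialParticleHole (spinDownOrbitals : Finset (Orb (Fin a ×ₗ Fin b))))ᴴ *
            dWaveSourceOpenBox a b U μ h *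
            partialParticleHole (spinDownOrbitals : Finset (Orb (Fin a ×ₗ Fin b)))) *ᵥ toSpinVec.symm Ψ) =
      (∑ i : Orb (Fin a ×ₗ Fin b), ∑ j : Orb (Fin a ×ₗ Fin b),
          bdgNambuMatrix
              (fun x y : Fin a ×ₗ Fin b => if (rectBoxGraph a b).Adj x y then -(1 : ℂ) else 0)
              (fun u v : Fin a ×ₗ Fin b => -(h : ℂ) * dWaveBoxPairWeight a b (u, v)) μ i j *
            sweepPairing (a * b) A
              (fun k => orbWordFamily (ofLex i).1 (ofLex j).1 (ofLex i).2 (ofLex j).2 (e k)) l l r r) -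
        (μ : ℂ) * ((a : ℂ) * (b : ℂ)) * sweepPairing (a * b) A (fun _ => (1 : Matrix (Fin 4) (Fin 4) ℂ)) l l r r +
        (U : ℂ) * ((∑ x : Fin a ×ₗ Fin b, sweepPairing (a * b) A
            (fun k => Function.update (fun _ => (1 : Matrix (Fin 4) (Fin 4) ℂ)) x (siteNumber 0) (e k)) l l r r) -
          ∑ x : Fin a ×ₗ Fin b, sweepPairing (a * b) A
            (fun k => Function.update (fun _ => (1 : Matrix (Fin 4) (Fin 4) ℂ)) x siteDouble (e k)) l l r r) := by
  intro Ψ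
  -- Fock-side distribution of `W A Wᴴ = dΓ(𝓗) − μ·ab·1 + U (N_↑ − Σ n↑n↓)`
  rw [partialParticleHole_conjTranspose_conj_eq, partialParticleHole_conj_dWaveSourceOpenBox, add_mulVec,
    sub_mulVec, dotProduct_add, dotProduct_sub, smul_mulVec, one_mulVec, dotProduct_smul, smul_eq_mul, smul_mulVec,
    dotProduct_smul, smul_eq_mul, sub_mulVec, dotProduct_sub, Matrix.sum_mulVec, Matrix.sum_mulVec, dotProduct_sum,
    dotProduct_sum]
  -- each Fock-side expectation is the spin-side one of the pulled-back witness
  have hconv : ∀ M : Matrix (Finset (Orb (Fin a ×ₗ Fin b))) (Finset (Orb (Fin a ×ₗ Fin b))) ℂ,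
      star (toSpinVec.symm Ψ) ⬝ᵥ (M *ᵥ toSpinVec.symm Ψ) = star Ψ ⬝ᵥ (toSpin M *ᵥ Ψ) := fun M => by
    rw [← star_toSpinVec_dotProduct, ← toSpin_mulVec, LinearEquiv.apply_symm_apply]
  have hnorm : star (toSpinVec.symm Ψ) ⬝ᵥ toSpinVec.symm Ψ = star Ψ ⬝ᵥ Ψ := by
    rw [← star_toSpinVec_dotProduct, LinearEquiv.apply_symm_apply]
  simp only [hconv, hnorm]
  rw [inner_toSpin_dGamma_compEquiv_mpsOpenVar, star_compEquiv_dotProduct_mpsOpenVar]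
  congr 2
  congr 1
  · exact Finset.sum_congr rfl fun x _ => inner_toSpin_numberOp_compEquiv_mpsOpenVar x 0 e A l r
  · exact Finset.sum_congr rfl fun x _ => inner_toSpin_numberOp_mul_numberOp_compEquiv_mpsOpenVar x e A l r

/-- **The transformed norm is the norm sweep**: `star ψ̃ ⬝ᵥ ψ̃ = S(1)` for `ψ̃ = toSpinVec⁻¹ Ψ`. -/
theorem star_dotProduct_toSpinVec_symm_mpsOpenVar (a b : ℕ) (e : Fin (a * b) ≃ (Fin a ×ₗ Fin b))
    (A : Fin (a * b) → MPSTensor 4 D) (l r : Fin D → ℂ) :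
    let Ψ : TensorIndex (Fin a ×ₗ Fin b) 4 → ℂ := fun k => mpsOpenVar (a * b) A l r (fun i => k (e i))
    star (toSpinVec.symm Ψ) ⬝ᵥ toSpinVec.symm Ψ =
      sweepPairing (a * b) A (fun _ => (1 : Matrix (Fin 4) (Fin 4) ℂ)) l l r r := by
  intro Ψ
  rw [← star_toSpinVec_dotProduct, LinearEquiv.apply_symm_apply, star_compEquiv_dotProduct_mpsOpenVar]

end SourcedBox

end Summit.Ventures.CertifiedManyBodySolver.Upper.IntervalReader

end
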